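/-
Copyright (c) 2026 the pub-hodgecm-mathlib formalisation cell (harness21).  Prover seat hodgecm-mathlib-B-p14 (g37), 2026-09-01.  «S3-ram» seeding wave (LEAD F0P3a-plan (g12)
T11-50 (1)(b)): RIGID-2-ram, REGULAR TYPE — tame-ramified twin of ★ `levelTwo_conj_upperUnipotent_one_of_two_deep` (cert «S3-ram (iv)» 446431ae).
-/
import Literature.NumberTheory.Automorphic.UnitaryThreeBoundaryRigidityLevelTwoRamified     -- ★ file I (this seat, p846855): currency; brings ★ inert RIGID-2 (A1)(A2)(B) generic lemmas
import Literature.NumberTheory.Automorphic.UnitaryLatticeTreeFramesOfInvolution             -- ★ R5d (this seat, p846481): centre-free Cartan `exists_glInt_mul_pow_mul_glInt`, `mem_unitaryInt_of_coe_mem_glInt`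
import HarnessLib

/-!
# Boundary rigidity at level two at a TAMELY RAMIFIED place, II: the regular type — ONE level-2 class on the whole boundary (Rogawski 1990 §3.9 Prop. 3.9.1; Tits 1979 §3.3.3, §3.5)

Topic `NumberTheory/Automorphic`; namespace `Literature.NumberTheory.Automorphic.UnitaryGroup`.  THEOREMS ONLY (no definition, no instance, no notation, no named fact, no `sorry`);
kernel lane.  Cell `pub/hodgecm-mathlib` (D-0151), crux H413 = `stmt-HodgeConjecture-24833`; «S3-ram» seeding wave, LEAD T11-50 (1)(b): bytes of candidate (2) of the certificate
«S3-ram (iv)» (`CERT-S3ram-iv.B-p14g37.md` 446431ae: q = 3: 36∕36, 27∕27, 54∕54, 27∕27, 36∕36, 81∕81, 81∕81; q = 5: 150∕150, 100∕100, 150∕150 boundary vertices in ONE level-2 class).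
SETTING: valued field `K` (`Valued K ℤᵐ⁰`, and for the Cartan step the compatible `ValuativeRel`), `σ` an ISOMETRIC INVOLUTION (`hσσ`, `hvσ`), `ϖ` ANY uniformiser
(at a tame-ramified place ★ `ramifiedBlock_adicCompletion` supplies one with `σ ϖ = −ϖ`, not needed here), `σ` RESIDUALLY TRIVIAL (`hres` — the one ramified input), `|2| = 1`; `J₀ = antidiag(1,1,1)`, `U = U(σ, J₀)`, `K₀ = U ∩ GL₃(𝒪)`;
«`≡ (mod ϖ²)`» = ★ `IsIntMatrix ((ϖ ^ 2)⁻¹ • (· − ·))` (`mod ϖ_w²` = `mod ϖ_v`).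

THE MATHEMATICS.  Port of the inert chain ★ (A1) → (B) core → (A2) → (B) HEAD, whose `UnramifiedLocalConjDatum` is used there only through `σσ`, `vσ`, `|ϖ|`, `trace`: here
unbundled, trace element `½`, Cartan = the centre-free ★ `exists_glInt_mul_pow_mul_glInt` (any isometric involution, `a = diag(ϖ, 1, (σϖ)⁻¹)`, frame `(ϖ^p, 1, (σϖ)^{−p})`,
no flip case).  At depth `0` the element is residually REGULAR: if `|α| < 1` then `β + σβ ≡ −ασα (ϖ²)` (§1), `|σβ − β| < 1` (hres) and `|2| = 1` force `|β| < 1`, depth ≥ 1.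

* §1 `v_corner_trace_le_…_of_isometry` · §2 `exists_near_heisenberg_of_diag_conj_of_frame` · §3 `levelTwo_conj_upperUnipotent_one_of_near_heisenberg_of_isometry` · §4 `exists_levelTwo_conj_near_heisenberg_of_two_deep_of_involution` · §5 HEAD **`levelTwo_conj_upperUnipotent_one_of_two_deep_of_neg`** (conclusion STRING-EQUAL to the inert ★).

HONEST LABEL: HC_CM is proved only modulo the 2 remaining named inputs (hLiu418 24832, h413 24833) until rung 0 closes; elementary matrix algebra; «S3-ram» = Literature seeding.

## References
* [Rogawski1990] J. D. Rogawski, *Automorphic Representations of Unitary Groups in Three Variables* (1990), §1.10 p. 9, §3.9 p. 32, Prop. 3.9.1.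
* [Tits1979] J. Tits, *Reductive groups over local fields*, PSPM 33.1 (1979), §3.3.3, §3.5.  [BruhatTits1972] F. Bruhat, J. Tits, Publ. Math. IHÉS 41 (1972), (4.4.3).
-/

set_option autoImplicit false

noncomputable section
open Matrix
open scoped Valued WithZero Matrix MatrixGroups

namespace Literature.NumberTheory.Automorphic.UnitaryGroup
open Literature.NumberTheory.Automorphic Literature.NumberTheory.Automorphic.HermitianLattice Literature.NumberTheory.Automorphic.UnitaryLatticeTree

variable {K : Type*} [Field K] [Valued K ℤᵐ⁰]
/-! ## §1 Unitarity of a near-upper-unitriangular element at level two (isometric `σ`, any uniformiser) -/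
/-- **`β + σβ + σc·c ≡ 0 (mod ϖ²)`** for `x ∈ U(σ, J₀)` with `x ≡ (1, α, β; 0, 1, c; 0, 0, 1) (mod ϖ²)`, `β, c` integral — ★ `v_corner_trace_le_of_near_upperUnipotent` with the datum
unbundled to «`σ` isometric, `ϖ ≠ 0` integral» (adapted from ★ `UnitaryThreeLevelTwoCongruence`). [cite: Rogawski1990, §1.10 p. 9] -/
theorem v_corner_trace_le_of_near_upperUnipotent_of_isometry {σ : K →+* K} {ϖ : K} (hvσ : ∀ z, Valued.v (σ z) = Valued.v z) (hϖ0 : ϖ ≠ 0) (hϖv : Valued.v ϖ ≤ 1)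
    {x : GL (Fin 3) K} (hxU : x ∈ unitaryGroupOfForm σ ((StdForm.antidiagonal 3).over K)) {α β c : K} (hβ : Valued.v β ≤ 1) (hc : Valued.v c ≤ 1)
    (hx : IsIntMatrix ((ϖ ^ 2)⁻¹ • ((x : Matrix (Fin 3) (Fin 3) K) - !![1, α, β; 0, 1, c; 0, 0, 1]))) :
    Valued.v (β + σ β + σ c * c) ≤ Valued.v (ϖ ^ 2) := by
  have hϖ2 : (ϖ ^ 2 : K) ≠ 0 := pow_ne_zero _ hϖ0
  have hP1 : Valued.v (ϖ ^ 2) ≤ 1 := by rw [map_pow]; exact pow_le_one₀ zero_le hϖv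
  rw [isIntMatrix_inv_smul_iff hϖ2] at hx
  obtain ⟨τ, hτ⟩ : ∃ τ : Matrix (Fin 3) (Fin 3) K, (x : Matrix (Fin 3) (Fin 3) K) - !![1, α, β; 0, 1, c; 0, 0, 1] = τ := ⟨_, rfl⟩
  rw [hτ] at hx
  have hxe : ∀ i j, (x : Matrix (Fin 3) (Fin 3) K) i j = !![1, α, β; 0, 1, c; 0, 0, 1] i j + τ i j := fun i j => by
    rw [← hτ, Matrix.sub_apply]; ring
  have h02 : (x : Matrix (Fin 3) (Fin 3) K) 0 2 = β + τ 0 2 := by rw [hxe]; rfl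
  have h12 : (x : Matrix (Fin 3) (Fin 3) K) 1 2 = c + τ 1 2 := by rw [hxe]; rfl
  have h22 : (x : Matrix (Fin 3) (Fin 3) K) 2 2 = 1 + τ 2 2 := by rw [hxe]; rfl
  have hcol : (x : Matrix (Fin 3) (Fin 3) K) *ᵥ (Pi.single 2 1 : Fin 3 → K) = ![β + τ 0 2, c + τ 1 2, 1 + τ 2 2] := by
    rw [← h02, ← h12, ← h22]
    funext i; fin_cases i <;> simp [Matrix.mulVec, dotProduct, Pi.single_apply]
  have hR : B₀ σ 3 (Pi.single 2 1 : Fin 3 → K) (Pi.single 2 1) = 0 := by rw [B₀_three_apply]; simp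
  have hiso := (mem_unitaryGroupOfForm_antidiagonal_iff x).1 hxU (Pi.single 2 1) (Pi.single 2 1)
  rw [hcol, hR, B₀_three_apply] at hiso
  have e0 : (![β + τ 0 2, c + τ 1 2, 1 + τ 2 2] : Fin 3 → K) 0 = β + τ 0 2 := rfl
  have e1 : (![β + τ 0 2, c + τ 1 2, 1 + τ 2 2] : Fin 3 → K) 1 = c + τ 1 2 := rfl
  have e2 : (![β + τ 0 2, c + τ 1 2, 1 + τ 2 2] : Fin 3 → K) 2 = 1 + τ 2 2 := rfl
  rw [e0, e1, e2] at hiso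
  have key : β + σ β + σ c * c = -(σ β * τ 2 2 + σ (τ 0 2) * (1 + τ 2 2) + σ c * τ 1 2 + σ (τ 1 2) * (c + τ 1 2) + τ 0 2 + σ (τ 2 2) * (β + τ 0 2)) := by
    simp only [map_add, map_one] at hiso
    linear_combination hiso
  rw [key, Valuation.map_neg]
  have i02 : Valued.v (1 + τ 2 2) ≤ 1 := v_add_le_of_le (by rw [map_one]) ((hx 2 2).trans hP1)
  have ic : Valued.v (c + τ 1 2) ≤ 1 := v_add_le_of_le hc ((hx 1 2).trans hP1)
  have ib : Valued.v (β + τ 0 2) ≤ 1 := v_add_le_of_le hβ ((hx 0 2).trans hP1)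
  refine v_add_le_of_le (v_add_le_of_le (v_add_le_of_le (v_add_le_of_le (v_add_le_of_le ?_ ?_) ?_) ?_) (hx 0 2)) ?_
  · exact v_mul_le_of_le_one_of_le (by rw [hvσ]; exact hβ) (hx 2 2)
  · exact v_mul_le_of_le_of_le_one (by rw [hvσ]; exact hx 0 2) i02
  · exact v_mul_le_of_le_one_of_le (by rw [hvσ]; exact hc) (hx 1 2)
  · exact v_mul_le_of_le_of_le_one (by rw [hvσ]; exact hx 1 2) ic
  · exact v_mul_le_of_le_of_le_one (by rw [hvσ]; exact hx 2 2) ib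

/-! ## §2 The core of the bridge for a general apartment frame -/
/-- **CORE OF THE BRIDGE (any frame)**: `γ′ ≡ 1 (mod ϖ²)`, `e = (e₀, e₁, e₂)` with `|e₀| ≤ 1`, `|e₁| = 1`, `|e₀e₂| = 1`, `y = diag(e)⁻¹ γ′ diag(e)` integral and unitary ⇒
`y ≡ u(y₀₁, y₀₂) (mod ϖ²)` — ★ `exists_near_heisenberg_of_diag_conj` with the frame condition `e₀e₂ = 1 = e₁²` relaxed to valuations (ramified frame `(ϖ^p, 1, (−1)^p ϖ^{−p})`).
[cite: Tits1979, §3.3.3] [cite: Rogawski1990, §3.9 p. 32] -/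
theorem exists_near_heisenberg_of_diag_conj_of_frame {σ : K →+* K} {ϖ : K} (hvσ : ∀ z, Valued.v (σ z) = Valued.v z) (hϖ0 : ϖ ≠ 0) (hϖv : Valued.v ϖ ≤ 1)
    {γ' : Matrix (Fin 3) (Fin 3) K} (hγ' : IsIntMatrix ((ϖ ^ 2)⁻¹ • (γ' - 1))) {e : Fin 3 → K} (he0 : e 0 ≠ 0) (he0v : Valued.v (e 0) ≤ 1)
    (he1 : Valued.v (e 1) = 1) (he02 : Valued.v (e 0 * e 2) = 1)
    {y : GL (Fin 3) K} (hyU : y ∈ unitaryGroupOfForm σ ((StdForm.antidiagonal 3).over K))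
    (hyint : IsIntMatrix (y : Matrix (Fin 3) (Fin 3) K)) (hy : ∀ i j, (y : Matrix (Fin 3) (Fin 3) K) i j = (e i)⁻¹ * γ' i j * e j) :
    ∃ α β : K, Valued.v α ≤ 1 ∧ Valued.v β ≤ 1 ∧
      IsIntMatrix ((ϖ ^ 2)⁻¹ • ((y : Matrix (Fin 3) (Fin 3) K) - !![1, α, β; 0, 1, -σ α; 0, 0, 1])) := by
  have hϖ2 : (ϖ ^ 2 : K) ≠ 0 := pow_ne_zero _ hϖ0
  have hP1 : Valued.v (ϖ ^ 2) ≤ 1 := by rw [map_pow]; exact pow_le_one₀ zero_le hϖv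
  set P := Valued.v (ϖ ^ 2) with hP
  obtain ⟨τ, hτ⟩ : ∃ τ : Matrix (Fin 3) (Fin 3) K, γ' - 1 = τ := ⟨_, rfl⟩
  have hτP : ∀ i j, Valued.v (τ i j) ≤ P := by rw [← hτ, ← isIntMatrix_inv_smul_iff hϖ2]; exact hγ'
  have hγe : ∀ i j, γ' i j = (1 : Matrix (Fin 3) (Fin 3) K) i j + τ i j := fun i j => by rw [← hτ, Matrix.sub_apply]; ring
  -- the frame
  have he1' : e 1 ≠ 0 := fun h => by rw [h, map_zero] at he1; exact zero_ne_one he1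
  have he02' : e 0 * e 2 ≠ 0 := fun h => by rw [h, map_zero] at he02; exact zero_ne_one he02
  have he2' : e 2 ≠ 0 := fun h => he02' (by rw [h, mul_zero])
  have he1i : Valued.v (e 1)⁻¹ = 1 := by rw [map_inv₀, he1, inv_one]
  have he2i : Valued.v (e 2)⁻¹ = Valued.v (e 0) := by
    rw [map_mul] at he02
    rw [map_inv₀, (eq_inv_of_mul_eq_one_left he02)]
  -- the entries of `y`
  have y00 : (y : Matrix (Fin 3) (Fin 3) K) 0 0 = 1 + τ 0 0 := by rw [hy, hγe, Matrix.one_apply_eq]; field_simp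
  have y11 : (y : Matrix (Fin 3) (Fin 3) K) 1 1 = 1 + τ 1 1 := by rw [hy, hγe, Matrix.one_apply_eq]; field_simp
  have y22 : (y : Matrix (Fin 3) (Fin 3) K) 2 2 = 1 + τ 2 2 := by rw [hy, hγe, Matrix.one_apply_eq]; field_simp
  have y10 : (y : Matrix (Fin 3) (Fin 3) K) 1 0 = (e 1)⁻¹ * τ 1 0 * e 0 := by
    rw [hy, hγe, Matrix.one_apply_ne (by decide), zero_add]
  have y20 : (y : Matrix (Fin 3) (Fin 3) K) 2 0 = (e 2)⁻¹ * τ 2 0 * e 0 := by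
    rw [hy, hγe, Matrix.one_apply_ne (by decide), zero_add]
  have y21 : (y : Matrix (Fin 3) (Fin 3) K) 2 1 = (e 2)⁻¹ * τ 2 1 * e 1 := by
    rw [hy, hγe, Matrix.one_apply_ne (by decide), zero_add]
  have v10 : Valued.v ((y : Matrix (Fin 3) (Fin 3) K) 1 0) ≤ P := by
    rw [y10]; exact v_mul_le_of_le_of_le_one (v_mul_le_of_le_one_of_le he1i.le (hτP 1 0)) he0v
  have v20 : Valued.v ((y : Matrix (Fin 3) (Fin 3) K) 2 0) ≤ P := by
    rw [y20]; exact v_mul_le_of_le_of_le_one (v_mul_le_of_le_one_of_le (by rw [he2i]; exact he0v) (hτP 2 0)) he0v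
  have v21 : Valued.v ((y : Matrix (Fin 3) (Fin 3) K) 2 1) ≤ P := by
    rw [y21]; exact v_mul_le_of_le_of_le_one (v_mul_le_of_le_one_of_le (by rw [he2i]; exact he0v) (hτP 2 1)) he1.le
  -- unitarity: `B₀(y e₁, y e₂) = 0` gives the `(1,2)` slot
  have hcol : ∀ j : Fin 3, (y : Matrix (Fin 3) (Fin 3) K) *ᵥ (Pi.single j 1 : Fin 3 → K) = fun i => (y : Matrix (Fin 3) (Fin 3) K) i j := fun j => by
    funext i; simp [Matrix.mulVec, dotProduct, Pi.single_apply]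
  have hR : B₀ σ 3 (Pi.single 1 1 : Fin 3 → K) (Pi.single 2 1) = 0 := by rw [B₀_three_apply]; simp
  have hiso := (mem_unitaryGroupOfForm_antidiagonal_iff y).1 hyU (Pi.single 1 1) (Pi.single 2 1)
  rw [hcol, hcol, hR, B₀_three_apply] at hiso
  simp only [y11, y22] at hiso
  have key : (y : Matrix (Fin 3) (Fin 3) K) 1 2 + σ ((y : Matrix (Fin 3) (Fin 3) K) 0 1) =
      -(σ ((y : Matrix (Fin 3) (Fin 3) K) 0 1) * τ 2 2 + σ (τ 1 1) * (y : Matrix (Fin 3) (Fin 3) K) 1 2 +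
        σ ((y : Matrix (Fin 3) (Fin 3) K) 2 1) * (y : Matrix (Fin 3) (Fin 3) K) 0 2) := by
    simp only [map_add, map_one] at hiso
    linear_combination hiso
  have v12 : Valued.v ((y : Matrix (Fin 3) (Fin 3) K) 1 2 + σ ((y : Matrix (Fin 3) (Fin 3) K) 0 1)) ≤ P := by
    rw [key, Valuation.map_neg]
    refine v_add_le_of_le (v_add_le_of_le ?_ ?_) ?_
    · exact v_mul_le_of_le_one_of_le (by rw [hvσ]; exact hyint 0 1) (hτP 2 2)
    · exact v_mul_le_of_le_of_le_one (by rw [hvσ]; exact hτP 1 1) (hyint 1 2)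
    · exact v_mul_le_of_le_of_le_one (by rw [hvσ]; exact v21) (hyint 0 2)
  refine ⟨(y : Matrix (Fin 3) (Fin 3) K) 0 1, (y : Matrix (Fin 3) (Fin 3) K) 0 2, hyint 0 1, hyint 0 2, ?_⟩
  rw [isIntMatrix_inv_smul_iff hϖ2]
  intro i j
  fin_cases i <;> fin_cases j
  · show Valued.v ((y : Matrix (Fin 3) (Fin 3) K) 0 0 - 1) ≤ P
    rw [y00, add_sub_cancel_left]; exact hτP 0 0
  · show Valued.v ((y : Matrix (Fin 3) (Fin 3) K) 0 1 - (y : Matrix (Fin 3) (Fin 3) K) 0 1) ≤ P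
    rw [sub_self, map_zero]; exact zero_le
  · show Valued.v ((y : Matrix (Fin 3) (Fin 3) K) 0 2 - (y : Matrix (Fin 3) (Fin 3) K) 0 2) ≤ P
    rw [sub_self, map_zero]; exact zero_le
  · show Valued.v ((y : Matrix (Fin 3) (Fin 3) K) 1 0 - 0) ≤ P
    rw [sub_zero]; exact v10
  · show Valued.v ((y : Matrix (Fin 3) (Fin 3) K) 1 1 - 1) ≤ P
    rw [y11, add_sub_cancel_left]; exact hτP 1 1
  · show Valued.v ((y : Matrix (Fin 3) (Fin 3) K) 1 2 - -σ ((y : Matrix (Fin 3) (Fin 3) K) 0 1)) ≤ P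
    rw [sub_neg_eq_add]; exact v12
  · show Valued.v ((y : Matrix (Fin 3) (Fin 3) K) 2 0 - 0) ≤ P
    rw [sub_zero]; exact v20
  · show Valued.v ((y : Matrix (Fin 3) (Fin 3) K) 2 1 - 0) ≤ P
    rw [sub_zero]; exact v21
  · show Valued.v ((y : Matrix (Fin 3) (Fin 3) K) 2 2 - 1) ≤ P
    rw [y22, add_sub_cancel_left]; exact hτP 2 2

/-! ## §3 The level-two class of a residually regular Heisenberg element (isometric involution, trace element `½`) -/
/-- **`x ≡ u(α, β) (mod ϖ²)` with `|α| = 1` is `K₀`-conjugate mod `ϖ²` to `u(1, b₀)`** for every `b₀` with `b₀ + σb₀ + 1 = 0`, `|b₀| ≤ 1` — ★ `levelTwo_conj_upperUnipotent_one_of_near_heisenberg`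
with the datum unbundled to «`σ` an isometric involution, `ϖ ≠ 0` integral, `|2| = 1`» (trace element `½`; torus `d(α⁻¹)`, then `u(s, ·)`, `s = −δ∕2`); adapted from ★
`UnitaryThreeLevelTwoHeisenbergClasses`. [cite: Rogawski1990, §3.9 Prop. 3.9.1 p. 32] [cite: Tits1979, §3.5] -/
theorem levelTwo_conj_upperUnipotent_one_of_near_heisenberg_of_isometry {σ : K →+* K} {ϖ : K} (hσσ : ∀ z, σ (σ z) = z) (hvσ : ∀ z, Valued.v (σ z) = Valued.v z)
    (hϖ0 : ϖ ≠ 0) (hϖv : Valued.v ϖ ≤ 1) (h2 : Valued.v (2 : K) = 1)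
    {x : GL (Fin 3) K} (hxU : x ∈ unitaryGroupOfForm σ ((StdForm.antidiagonal 3).over K)) {α β : K} (hα : Valued.v α = 1) (hβ : Valued.v β ≤ 1)
    (hx : IsIntMatrix ((ϖ ^ 2)⁻¹ • ((x : Matrix (Fin 3) (Fin 3) K) - !![1, α, β; 0, 1, -σ α; 0, 0, 1])))
    {b₀ : K} (hb₀ : b₀ + σ b₀ + 1 = 0) (hb₀v : Valued.v b₀ ≤ 1) :
    ∃ k : GL (Fin 3) K, k ∈ unitaryGroupOfForm σ ((StdForm.antidiagonal 3).over K) ∧ IsIntMatrix (k : Matrix (Fin 3) (Fin 3) K) ∧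
      IsIntMatrix ((k⁻¹ : GL (Fin 3) K) : Matrix (Fin 3) (Fin 3) K) ∧
      IsIntMatrix ((ϖ ^ 2)⁻¹ • (((k * x * k⁻¹ : GL (Fin 3) K) : Matrix (Fin 3) (Fin 3) K) - !![1, 1, b₀; 0, 1, -1; 0, 0, 1])) := by
  have hϖ2 : (ϖ ^ 2 : K) ≠ 0 := pow_ne_zero _ hϖ0
  set P := Valued.v (ϖ ^ 2) with hP
  have h20 : (2 : K) ≠ 0 := fun h => by rw [h, map_zero] at h2; exact zero_ne_one h2
  have hσ2 : σ (2 : K) = 2 := map_ofNat σ 2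
  have hα0 : α ≠ 0 := fun h => by rw [h, map_zero] at hα; exact zero_ne_one hα
  have hσαv : Valued.v (σ α) = 1 := by rw [hvσ, hα]
  have hσα0 : σ α ≠ 0 := (map_ne_zero σ).2 hα0
  -- Step 1: the torus `d(α⁻¹)` normalises `α` to `1`
  have hz0 : α⁻¹ ≠ 0 := inv_ne_zero hα0
  obtain ⟨d, hdd, hdd'⟩ := exists_units_coe_eq_torusElt σ hz0
  have hdU := torusElt_mem_unitaryGroupOfForm σ hz0 (hσσ _) hdd
  have hσi : σ α⁻¹ = (σ α)⁻¹ := map_inv₀ σ α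
  have hdint : IsIntMatrix (d : Matrix (Fin 3) (Fin 3) K) := by
    rw [hdd]; exact isIntMatrix_diagonal_three (by rw [map_inv₀, hα, inv_one]) (by rw [map_one]) (by rw [hσi, inv_inv]; exact hσαv.le)
  have hdint' : IsIntMatrix ((d⁻¹ : GL (Fin 3) K) : Matrix (Fin 3) (Fin 3) K) := by
    rw [hdd']; exact isIntMatrix_diagonal_three (by rw [inv_inv]; exact hα.le) (by rw [map_one]) (by rw [hσi, map_inv₀, hσαv, inv_one])
  obtain ⟨β', hβ'⟩ : ∃ β' : K, α⁻¹ * (σ α)⁻¹ * β = β' := ⟨_, rfl⟩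
  have hβ'v : Valued.v β' ≤ 1 := by rw [← hβ', map_mul, map_mul, map_inv₀, map_inv₀, hα, hσαv, inv_one, one_mul, one_mul]; exact hβ
  have hE1 : (d : Matrix (Fin 3) (Fin 3) K) * !![1, α, β; 0, 1, -σ α; 0, 0, 1] * ((d⁻¹ : GL (Fin 3) K) : Matrix (Fin 3) (Fin 3) K) = !![1, 1, β'; 0, 1, -1; 0, 0, 1] := by
    rw [hdd, hdd', hσi, ← hβ']
    ext i j
    fin_cases i <;> fin_cases j <;> (simp [Matrix.mul_apply, Matrix.diagonal, hα0, hσα0]; try ring)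
  have hy1 : IsIntMatrix ((ϖ ^ 2)⁻¹ • ((d : Matrix (Fin 3) (Fin 3) K) * (x : Matrix (Fin 3) (Fin 3) K) * ((d⁻¹ : GL (Fin 3) K) : Matrix (Fin 3) (Fin 3) K) -
      !![1, 1, β'; 0, 1, -1; 0, 0, 1])) := by
    refine isIntMatrix_smul_conj_sub _ hdint hdint' hx ?_
    rw [hE1, sub_self, smul_zero]; exact isIntMatrix_zero
  have hy1U : d * x * d⁻¹ ∈ unitaryGroupOfForm σ ((StdForm.antidiagonal 3).over K) := mul_mem (mul_mem hdU hxU) (inv_mem hdU)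
  have hy1' : IsIntMatrix ((ϖ ^ 2)⁻¹ • (((d * x * d⁻¹ : GL (Fin 3) K) : Matrix (Fin 3) (Fin 3) K) - !![1, 1, β'; 0, 1, -σ 1; 0, 0, 1])) := by
    rw [map_one, Units.val_mul, Units.val_mul]; exact hy1
  have htr := v_corner_trace_le_of_near_upperUnipotent_of_isometry hvσ hϖ0 hϖv hy1U (c := -σ 1) hβ'v (by rw [map_one, Valuation.map_neg, map_one]) hy1'
  rw [map_one, map_neg, map_one, neg_mul_neg, one_mul] at htr
  -- Step 2: the Heisenberg element `u(s, ·)`, `s = −δ∕2`, `δ = b₀ − β′`; trace element `t₁ = ½`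
  obtain ⟨δ, hδ⟩ : ∃ δ : K, b₀ - β' = δ := ⟨_, rfl⟩
  have hδv : Valued.v δ ≤ 1 := by rw [← hδ]; exact v_sub_le_of_le hb₀v hβ'v
  have hδtr : Valued.v (δ + σ δ) ≤ P := by
    have h : δ + σ δ = -(β' + σ β' + 1) := by rw [← hδ, map_sub]; linear_combination hb₀
    rw [h, Valuation.map_neg]; exact htr
  obtain ⟨t₁, ht₁⟩ : ∃ t₁ : K, (2 : K)⁻¹ = t₁ := ⟨_, rfl⟩
  have ht₁v : Valued.v t₁ ≤ 1 := by rw [← ht₁, map_inv₀, h2, inv_one]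
  have ht₁' : t₁ + σ t₁ = 1 := by rw [← ht₁, map_inv₀, hσ2]; field_simp; norm_num
  obtain ⟨s, hs⟩ : ∃ s : K, -δ / 2 = s := ⟨_, rfl⟩
  have hsv : Valued.v s ≤ 1 := by rw [← hs, map_div₀, Valuation.map_neg, h2, div_one]; exact hδv
  have hσsv : Valued.v (σ s) ≤ 1 := by rw [hvσ]; exact hsv
  obtain ⟨b₂, hb₂⟩ : ∃ b₂ : K, -(s * σ s) * t₁ = b₂ := ⟨_, rfl⟩
  have hb₂v : Valued.v b₂ ≤ 1 := by
    rw [← hb₂, neg_mul, Valuation.map_neg]; exact v_mul_le_of_le_one_of_le (v_mul_le_of_le_one_of_le hsv hσsv) ht₁v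
  obtain ⟨m, hm, hm'⟩ := exists_units_coe_eq_upperTriangularUnipotent s b₂ (-σ s)
  have hmU : m ∈ unitaryGroupOfForm σ ((StdForm.antidiagonal 3).over K) :=
    (mem_unitaryGroupOfForm_iff_of_coe_eq_upperUnipotent σ hσσ hm).2 ⟨rfl, by
      rw [← hb₂, map_mul, map_neg, map_mul, hσσ]; linear_combination (-(s * σ s)) * ht₁'⟩
  have hmint : IsIntMatrix (m : Matrix (Fin 3) (Fin 3) K) := by
    rw [hm]; exact isIntMatrix_upperUnipotent hsv hb₂v (by rw [Valuation.map_neg]; exact hσsv)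
  have hmint' : IsIntMatrix ((m⁻¹ : GL (Fin 3) K) : Matrix (Fin 3) (Fin 3) K) := by
    rw [hm']
    refine isIntMatrix_upperUnipotent (by rw [Valuation.map_neg]; exact hsv) (v_sub_le_of_le ?_ hb₂v) (by rw [neg_neg]; exact hσsv)
    exact v_mul_le_of_le_one_of_le hsv (by rw [Valuation.map_neg]; exact hσsv)
  have hE2 : (m : Matrix (Fin 3) (Fin 3) K) * !![1, 1, β'; 0, 1, -1; 0, 0, 1] * ((m⁻¹ : GL (Fin 3) K) : Matrix (Fin 3) (Fin 3) K) - !![1, 1, b₀; 0, 1, -1; 0, 0, 1] =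
      !![0, 0, β' - s + σ s - b₀; 0, 0, 0; 0, 0, 0] := by
    rw [hm, hm']
    ext i j
    fin_cases i <;> fin_cases j <;> (simp; try ring)
  have hy2 : IsIntMatrix ((ϖ ^ 2)⁻¹ • ((m : Matrix (Fin 3) (Fin 3) K) * ((d : Matrix (Fin 3) (Fin 3) K) * (x : Matrix (Fin 3) (Fin 3) K) *
      ((d⁻¹ : GL (Fin 3) K) : Matrix (Fin 3) (Fin 3) K)) * ((m⁻¹ : GL (Fin 3) K) : Matrix (Fin 3) (Fin 3) K) - !![1, 1, b₀; 0, 1, -1; 0, 0, 1])) := by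
    refine isIntMatrix_smul_conj_sub _ hmint hmint' hy1 ?_
    rw [hE2, isIntMatrix_inv_smul_iff hϖ2]
    have he : β' - s + σ s - b₀ = -(δ + σ δ) / 2 := by
      rw [← hs, map_div₀, map_neg, hσ2, ← hδ, map_sub]; field_simp; ring
    have hev : Valued.v (β' - s + σ s - b₀) ≤ P := by
      rw [he, map_div₀, Valuation.map_neg, h2, div_one]; exact hδtr
    intro i j
    fin_cases i <;> fin_cases j <;> first | exact hev | simp
  refine ⟨m * d, mul_mem hmU hdU, ?_, ?_, ?_⟩
  · rw [Units.val_mul]; exact isIntMatrix_mul hmint hdint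
  · rw [_root_.mul_inv_rev, Units.val_mul]; exact isIntMatrix_mul hdint' hmint'
  · have h : ((m * d * x * (m * d)⁻¹ : GL (Fin 3) K) : Matrix (Fin 3) (Fin 3) K) =
        (m : Matrix (Fin 3) (Fin 3) K) * ((d : Matrix (Fin 3) (Fin 3) K) * (x : Matrix (Fin 3) (Fin 3) K) * ((d⁻¹ : GL (Fin 3) K) : Matrix (Fin 3) (Fin 3) K)) *
          ((m⁻¹ : GL (Fin 3) K) : Matrix (Fin 3) (Fin 3) K) := by
      rw [_root_.mul_inv_rev, show m * d * x * (d⁻¹ * m⁻¹) = m * (d * x * d⁻¹) * m⁻¹ by group]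
      simp only [Units.val_mul]
    rw [h]; exact hy2


/-! ## §4 The bridge: apartment normal form mod `ϖ²` from the centre-free Cartan decomposition (any isometric involution) -/
/-- **APARTMENT NORMAL FORM MOD `ϖ²` (any isometric involution `σ`, any uniformiser `ϖ`)**: `γ ∈ U(σ, J₀)` `2`-deep at `𝒪³`, `g ∈ U` with `x = g⁻¹γg` integral ⇒ `x` is
`K₀`-conjugate mod `ϖ²` to some `u(α, β)`, `α, β` integral (★ `exists_glInt_mul_pow_mul_glInt`: `g = k₁ a^p k₂`, so `k₂ x k₂⁻¹ = a^{−p} (k₁⁻¹γk₁) a^p`, frame `(ϖ^p, 1, (σϖ)^{−p})`,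
§2; no flip case).  Twin of ★ `exists_levelTwo_conj_near_heisenberg_of_two_deep`. [cite: Tits1979, §3.3.3] [cite: BruhatTits1972, (4.4.3)] [cite: Rogawski1990, §3.9 p. 32] -/
theorem exists_levelTwo_conj_near_heisenberg_of_two_deep_of_involution [ValuativeRel K] [(Valued.v : Valuation K ℤᵐ⁰).Compatible]
    {σ : K →+* K} {ϖ : K} (hσσ : ∀ z, σ (σ z) = z) (hvσ : ∀ z, Valued.v (σ z) = Valued.v z) (hϖ : Valued.v ϖ = WithZero.exp (-1 : ℤ))
    {γ g x : GL (Fin 3) K} (hγU : γ ∈ unitaryGroupOfForm σ ((StdForm.antidiagonal 3).over K))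
    (hγ2 : IsIntMatrix ((ϖ ^ 2)⁻¹ • ((γ : Matrix (Fin 3) (Fin 3) K) - 1)))
    (hgU : g ∈ unitaryGroupOfForm σ ((StdForm.antidiagonal 3).over K)) (hxg : x = g⁻¹ * γ * g) (hxint : IsIntMatrix (x : Matrix (Fin 3) (Fin 3) K)) :
    ∃ k : GL (Fin 3) K, k ∈ unitaryGroupOfForm σ ((StdForm.antidiagonal 3).over K) ∧ IsIntMatrix (k : Matrix (Fin 3) (Fin 3) K) ∧
      IsIntMatrix ((k⁻¹ : GL (Fin 3) K) : Matrix (Fin 3) (Fin 3) K) ∧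
      ∃ α β : K, Valued.v α ≤ 1 ∧ Valued.v β ≤ 1 ∧
        IsIntMatrix ((ϖ ^ 2)⁻¹ • (((k * x * k⁻¹ : GL (Fin 3) K) : Matrix (Fin 3) (Fin 3) K) - !![1, α, β; 0, 1, -σ α; 0, 0, 1])) := by
  have hϖ0 : ϖ ≠ 0 := fun h => by rw [h, map_zero] at hϖ; exact WithZero.zero_ne_coe hϖ
  have hϖv : Valued.v ϖ ≤ 1 := by rw [hϖ, ← WithZero.exp_zero, WithZero.exp_le_exp]; norm_num
  have hσϖ0 : σ ϖ ≠ 0 := (map_ne_zero σ).2 hϖ0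
  -- Cartan `g = k₁ a^p k₂`
  obtain ⟨a, ha⟩ := UnitaryGroup.exists_coe_eq_diagonal_uniformizer σ (rfl : (StdForm.antidiagonal 3).over K = (StdForm.antidiagonal 3).over K) hσσ hϖ0
  obtain ⟨k₁, hk₁, k₂, hk₂, p, hg⟩ := UnitaryGroup.exists_glInt_mul_pow_mul_glInt σ rfl hσσ hvσ hϖ a ha ⟨g, hgU⟩
  have hκ₁ := mem_unitaryInt_iff.1 (mem_unitaryInt_of_coe_mem_glInt hvσ hk₁)
  have hκ₂ := mem_unitaryInt_iff.1 (mem_unitaryInt_of_coe_mem_glInt hvσ hk₂)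
  have hk₁i : IsIntMatrix (((k₁ : ↥(unitaryGroupOfForm σ ((StdForm.antidiagonal 3).over K))) : GL (Fin 3) K) : Matrix (Fin 3) (Fin 3) K) := hκ₁.1
  have hk₁i' : IsIntMatrix ((((k₁ : ↥(unitaryGroupOfForm σ ((StdForm.antidiagonal 3).over K))) : GL (Fin 3) K)⁻¹ : GL (Fin 3) K) : Matrix (Fin 3) (Fin 3) K) := hκ₁.2
  have hk₂i : IsIntMatrix (((k₂ : ↥(unitaryGroupOfForm σ ((StdForm.antidiagonal 3).over K))) : GL (Fin 3) K) : Matrix (Fin 3) (Fin 3) K) := hκ₂.1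
  have hk₂i' : IsIntMatrix ((((k₂ : ↥(unitaryGroupOfForm σ ((StdForm.antidiagonal 3).over K))) : GL (Fin 3) K)⁻¹ : GL (Fin 3) K) : Matrix (Fin 3) (Fin 3) K) := hκ₂.2
  set K₁ : GL (Fin 3) K := ((k₁ : ↥(unitaryGroupOfForm σ ((StdForm.antidiagonal 3).over K))) : GL (Fin 3) K) with hK₁
  set K₂ : GL (Fin 3) K := ((k₂ : ↥(unitaryGroupOfForm σ ((StdForm.antidiagonal 3).over K))) : GL (Fin 3) K) with hK₂
  set A : GL (Fin 3) K := ((a ^ p : ↥(unitaryGroupOfForm σ ((StdForm.antidiagonal 3).over K))) : GL (Fin 3) K) with hA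
  have hgGL : g = K₁ * A * K₂ := by
    have h := congrArg (fun u : ↥(unitaryGroupOfForm σ ((StdForm.antidiagonal 3).over K)) => (u : GL (Fin 3) K)) hg
    simpa only [Subgroup.coe_mul] using h
  have hAmat : (A : Matrix (Fin 3) (Fin 3) K) = Matrix.diagonal ![ϖ ^ p, 1, (σ ϖ)⁻¹ ^ p] := UnitaryGroup.coe_pow_eq_diagonal σ a ha p
  -- the frame `e = (ϖ^p, 1, (σϖ)^{-p})`
  set e : Fin 3 → K := ![ϖ ^ p, 1, (σ ϖ)⁻¹ ^ p] with he
  have he0 : e 0 = ϖ ^ p := rfl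
  have he1 : e 1 = 1 := rfl
  have he2 : e 2 = (σ ϖ)⁻¹ ^ p := rfl
  have hei0 : ∀ i, e i ≠ 0 := by
    intro i; fin_cases i
    · exact pow_ne_zero _ hϖ0
    · exact one_ne_zero
    · exact pow_ne_zero _ (inv_ne_zero hσϖ0)
  have he0v : Valued.v (e 0) ≤ 1 := by rw [he0, map_pow]; exact pow_le_one₀ zero_le hϖv
  have he1v : Valued.v (e 1) = 1 := by rw [he1, map_one]
  have he02 : Valued.v (e 0 * e 2) = 1 := by
    rw [he0, he2, map_mul, map_pow, map_pow, map_inv₀, hvσ, ← mul_pow, mul_inv_cancel₀ ((Valuation.ne_zero_iff _).2 hϖ0), one_pow]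
  have hAinv : ((A⁻¹ : GL (Fin 3) K) : Matrix (Fin 3) (Fin 3) K) = Matrix.diagonal fun i => (e i)⁻¹ := by
    rw [Matrix.coe_units_inv, hAmat]
    refine Matrix.inv_eq_right_inv ?_
    rw [Matrix.diagonal_mul_diagonal, ← Matrix.diagonal_one]
    congr 1; funext i; exact mul_inv_cancel₀ (hei0 i)
  -- `γ′ = k₁⁻¹ γ k₁ ≡ 1 (mod ϖ²)` and `y = k₂ x k₂⁻¹ = A⁻¹ γ′ A`
  have hγ' : IsIntMatrix ((ϖ ^ 2)⁻¹ • (((K₁⁻¹ * γ * K₁ : GL (Fin 3) K) : Matrix (Fin 3) (Fin 3) K) - 1)) := by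
    rw [Units.val_mul, Units.val_mul]; exact isIntMatrix_smul_conj_sub_one _ hk₁i' hk₁i (Units.inv_mul K₁) hγ2
  have hxU : x ∈ unitaryGroupOfForm σ ((StdForm.antidiagonal 3).over K) := by rw [hxg]; exact mul_mem (mul_mem (inv_mem hgU) hγU) hgU
  have hy : K₂ * x * K₂⁻¹ = A⁻¹ * (K₁⁻¹ * γ * K₁) * A := by rw [hxg, hgGL]; group
  obtain ⟨α, β, hα, hβ, hc⟩ := exists_near_heisenberg_of_diag_conj_of_frame hvσ hϖ0 hϖv hγ' (e := e) (hei0 0) he0v he1v he02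
    (y := K₂ * x * K₂⁻¹) (mul_mem (mul_mem k₂.2 hxU) (inv_mem k₂.2))
    (by rw [Units.val_mul, Units.val_mul]; exact isIntMatrix_mul (isIntMatrix_mul hk₂i hxint) hk₂i')
    (fun i j => by rw [hy, Units.val_mul, Units.val_mul, hAinv, hAmat, Matrix.mul_diagonal, Matrix.diagonal_mul, mul_assoc])
  exact ⟨K₂, k₂.2, hk₂i, hk₂i', α, β, hα, hβ, hc⟩

/-! ## §5 RIGID-2-ram, regular type: ONE level-2 class on the whole boundary -/
/-- **HEAD (RIGID-2-ram, REGULAR TYPE = THE WHOLE BOUNDARY).**  `σ` an isometric involution, RESIDUALLY TRIVIAL (`hres`), `ϖ` a uniformiser, `|2| = 1`; `γ ∈ U(σ, J₀)` `2`-deep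
at `𝒪³` (`γ ≡ 1 (mod ϖ²)` = `mod ϖ_v`), `g·𝒪³` a `γ`-fixed self-dual vertex whose local element `x = g⁻¹γg` has DEPTH `0` (`x ≢ 1 (mod ϖ)`).  Then `x` is `K₀`-conjugate mod `ϖ²` to the
reference `u(1, b₀)` (`b₀ + σb₀ + 1 = 0`, `|b₀| ≤ 1`): ONE level-2 class on the whole boundary (§4: `x ~ u(α, β)`; `|α| < 1` would force `|β| < 1` by §1 + `hres` + `|2| = 1`, i.e.
depth ≥ 1; so `|α| = 1`, residually REGULAR (★ file I), and §3 applies).  Conclusion STRING-EQUAL to the inert ★ `levelTwo_conj_upperUnipotent_one_of_two_deep`; certificate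
«S3-ram (iv)» 446431ae (q = 3: 36∕36 … 81∕81; q = 5: 150∕150, 100∕100, 150∕150 in the class of `u(1, −1∕2)`).  The candidate's binders `hσϖ : σϖ = −ϖ`, `hnorm` are NOT needed
and dropped (residual triviality is the only ramified input); the name `_of_neg` is kept for the wave's sockets. [cite: Rogawski1990, §3.9 Prop. 3.9.1 p. 32] [cite: Tits1979, §3.3.3, §3.5] -/
theorem levelTwo_conj_upperUnipotent_one_of_two_deep_of_neg [ValuativeRel K] [(Valued.v : Valuation K ℤᵐ⁰).Compatible]
    {σ : K →+* K} {ϖ : K} (hσ : ∀ x, σ (σ x) = x) (hvσ : ∀ a, Valued.v (σ a) = Valued.v a)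
    (hϖ : Valued.v ϖ = WithZero.exp (-1 : ℤ)) (hres : ∀ x : K, Valued.v x ≤ 1 → Valued.v (σ x - x) < 1) (h2 : Valued.v (2 : K) = 1)
    {γ g x : GL (Fin 3) K} (hγU : γ ∈ unitaryGroupOfForm σ ((StdForm.antidiagonal 3).over K))
    (hγ2 : IsIntMatrix ((ϖ ^ 2)⁻¹ • ((γ : Matrix (Fin 3) (Fin 3) K) - 1)))
    (hgU : g ∈ unitaryGroupOfForm σ ((StdForm.antidiagonal 3).over K)) (hxg : x = g⁻¹ * γ * g) (hxint : IsIntMatrix (x : Matrix (Fin 3) (Fin 3) K))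
    (hx0 : ¬ IsIntMatrix (ϖ⁻¹ • ((x : Matrix (Fin 3) (Fin 3) K) - 1)))
    {b₀ : K} (hb₀ : b₀ + σ b₀ + 1 = 0) (hb₀v : Valued.v b₀ ≤ 1) :
    ∃ k : GL (Fin 3) K, k ∈ unitaryGroupOfForm σ ((StdForm.antidiagonal 3).over K) ∧ IsIntMatrix (k : Matrix (Fin 3) (Fin 3) K) ∧
      IsIntMatrix ((k⁻¹ : GL (Fin 3) K) : Matrix (Fin 3) (Fin 3) K) ∧
      IsIntMatrix ((ϖ ^ 2)⁻¹ • (((k * x * k⁻¹ : GL (Fin 3) K) : Matrix (Fin 3) (Fin 3) K) - !![1, 1, b₀; 0, 1, -1; 0, 0, 1])) := by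
  have hϖ0 : ϖ ≠ 0 := fun h => by rw [h, map_zero] at hϖ; exact WithZero.zero_ne_coe hϖ
  have hϖ1 : Valued.v ϖ < 1 := by rw [hϖ, ← WithZero.exp_zero, WithZero.exp_lt_exp]; norm_num
  have hϖv : Valued.v ϖ ≤ 1 := hϖ1.le
  have hϖ2 : (ϖ ^ 2 : K) ≠ 0 := pow_ne_zero _ hϖ0
  have hP : Valued.v (ϖ ^ 2) ≤ Valued.v ϖ := by rw [map_pow, sq]; exact mul_le_of_le_one_left zero_le hϖv
  have hσϖ2 : Valued.v (σ ϖ) = Valued.v ϖ := hvσ ϖ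
  have hxU : x ∈ unitaryGroupOfForm σ ((StdForm.antidiagonal 3).over K) := by rw [hxg]; exact mul_mem (mul_mem (inv_mem hgU) hγU) hgU
  -- §4: `y = k x k⁻¹ ≡ u(α, β) (mod ϖ²)`
  obtain ⟨k, hkU, hki, hki', α, β, hα1, hβ1, hy⟩ := exists_levelTwo_conj_near_heisenberg_of_two_deep_of_involution hσ hvσ hϖ hγU hγ2 hgU hxg hxint
  have hyU : k * x * k⁻¹ ∈ unitaryGroupOfForm σ ((StdForm.antidiagonal 3).over K) := mul_mem (mul_mem hkU hxU) (inv_mem hkU)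
  have hyE := (isIntMatrix_inv_smul_iff hϖ2 _).1 hy
  -- residual regularity: `|α| = 1`
  have hα : Valued.v α = 1 := by
    by_contra hne
    have hαlt : Valued.v α < 1 := lt_of_le_of_ne hα1 hne
    -- unitarity: `β + σβ + σ(−σα)(−σα) ≡ 0 (mod ϖ²)`
    have htr := v_corner_trace_le_of_near_upperUnipotent_of_isometry hvσ hϖ0 hϖv hyU (c := -σ α) hβ1
      (by rw [Valuation.map_neg, hvσ]; exact hα1) hy
    have hNα : Valued.v (σ (-σ α) * (-σ α)) < 1 := by
      rw [map_neg, hσ, neg_mul_neg, map_mul, hvσ]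
      exact (mul_le_of_le_one_left zero_le hα1).trans_lt hαlt
    have hβσ : Valued.v (β + σ β) < 1 := by
      have h : β + σ β = (β + σ β + σ (-σ α) * (-σ α)) - σ (-σ α) * (-σ α) := by ring
      rw [h]
      refine lt_of_le_of_lt (Valuation.map_sub _ _ _) (max_lt (lt_of_le_of_lt htr ?_) hNα)
      rw [map_pow]; exact pow_lt_one₀ zero_le hϖ1 two_ne_zero
    have h2β : Valued.v (2 * β) < 1 := by
      have h : 2 * β = (β + σ β) - (σ β - β) := by ring
      rw [h]
      exact lt_of_le_of_lt (Valuation.map_sub _ _ _) (max_lt hβσ (hres β hβ1))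
    have hβlt : Valued.v β < 1 := by rwa [map_mul, h2, one_mul] at h2β
    -- hence `y ≡ 1 (mod ϖ)`, so `x ≡ 1 (mod ϖ)`: contradiction with depth `0`
    have hy1 : IsIntMatrix (ϖ⁻¹ • (((k * x * k⁻¹ : GL (Fin 3) K) : Matrix (Fin 3) (Fin 3) K) - 1)) := by
      have hαϖ : Valued.v α ≤ Valued.v ϖ := by rw [hϖ]; exact (v_lt_one_iff α).1 hαlt
      have hβϖ : Valued.v β ≤ Valued.v ϖ := by rw [hϖ]; exact (v_lt_one_iff β).1 hβlt
      have hσαϖ : Valued.v (-σ α) ≤ Valued.v ϖ := by rw [Valuation.map_neg, hvσ]; exact hαϖ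
      have hsplit : ((k * x * k⁻¹ : GL (Fin 3) K) : Matrix (Fin 3) (Fin 3) K) - 1 =
          (((k * x * k⁻¹ : GL (Fin 3) K) : Matrix (Fin 3) (Fin 3) K) - !![1, α, β; 0, 1, -σ α; 0, 0, 1]) + !![0, α, β; 0, 0, -σ α; 0, 0, 0] := by
        rw [sub_add, sub_right_inj]
        ext i j
        fin_cases i <;> fin_cases j <;> simp
      rw [hsplit, smul_add]
      refine isIntMatrix_add ?_ ?_
      · rw [isIntMatrix_inv_smul_iff hϖ0]
        exact fun i j => (hyE i j).trans hP
      · rw [isIntMatrix_inv_smul_iff hϖ0]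
        intro i j
        fin_cases i <;> fin_cases j <;> first | exact hαϖ | exact hβϖ | exact hσαϖ | simp
    apply hx0
    have h := isIntMatrix_smul_conj_sub_one ϖ⁻¹ hki' hki (Units.inv_mul k) hy1
    rw [← Units.val_mul, ← Units.val_mul, show k⁻¹ * (k * x * k⁻¹) * k = x by group] at h
    exact h
  -- §3
  obtain ⟨k', hk'U, hk'i, hk'i', hk'⟩ := levelTwo_conj_upperUnipotent_one_of_near_heisenberg_of_isometry hσ hvσ hϖ0 hϖv h2 hyU hα hβ1 hy hb₀ hb₀v
  refine ⟨k' * k, mul_mem hk'U hkU, ?_, ?_, ?_⟩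
  · rw [Units.val_mul]; exact isIntMatrix_mul hk'i hki
  · rw [_root_.mul_inv_rev, Units.val_mul]; exact isIntMatrix_mul hki' hk'i'
  · rwa [show k' * k * x * (k' * k)⁻¹ = k' * (k * x * k⁻¹) * k'⁻¹ by group]

end Literature.NumberTheory.Automorphic.UnitaryGroup

end
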